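import Literature.NumberTheory.EllipticCurves.DeShalit1987.KatzMeasureTwistedLines
import Literature.NumberTheory.LocalFields.StrassmannTheorem
import HarnessLib

/-!
# The identity principle for bounded `p`-adic power series in one and two variables:
# an element of `𝒪_{ℂ_p}⟦T⟧` (resp. `𝒪_{ℂ_p}⟦T₁⟧⟦T₂⟧`) is determined by its values on any infinite
# subset (resp. product of infinite subsets) of a closed disc `‖x‖ ≤ ‖ϖ‖ < 1` (all PROVED)

Topic `Literature/NumberTheory/EllipticCurves`, namespace `Literature.NumberTheory.EllipticCurves`,
grouping sub-namespace `IntSeries` (the tree's receptacles `IntSeries.HasValueAt`,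
`IntSeries.HasValueAt₂` for the one- and two-variable Katz–de Shalit / Mazur–Swinnerton-Dyer frames:
`DeShalit1987.IsKatzBranch`, `IsKatzMeasure₂`). THEOREMS ONLY: no definition, no named fact, no
`sorry`, no `instance`.

WHY. Every frame of the tree characterises a power series `G` with `𝒪_{ℂ_p}`-coefficients by its
VALUES (`HasSum` statements at points of the open unit (poly)disc); relations between frames printed
as identities of measures or of power series (the `p`-adic functional equation de Shalit 1987 II.6.4,
typed pointwise as `DeShalit1987.thmII64_katzMeasure₂_functionalEquation`; the rigidity "two frames
for the same data differ by a unit"; the comparison of a line of a two-variable germ with a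
one-variable branch) become identities in `𝒪_{ℂ_p}⟦T⟧` / `𝒪_{ℂ_p}⟦T₁⟧⟦T₂⟧` only through an identity
principle. For coefficients tending to `0` the tree has Strassman's theorem and its corollaries
(`LocalFields.eq_zero_of_infinite_zeros`, Gouvêa Cor. 5.6.4); the frames' coefficients are merely
BOUNDED (`‖·‖ ≤ 1`), and a bounded series may have infinitely many zeros in the open disc
(`∑ p^{1/i} T^i`). The remedy is Gouvêa's Cor. 5.6.3: on a CLOSED disc `‖x‖ ≤ ‖ϖ‖` with `‖ϖ‖ < 1`
the rescaled coefficients `a_n ϖ^n` do tend to `0`, so infinitely many zeros there force the series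
to vanish. The two-variable statement follows fibrewise through the tree's line substitution
`IntSeries.lineSubst` (Rubin1991/TwoVariableCMLines §1: the line `T₁ = c` and
`hasValueAt_lineSubst_iff`) and the transposition `IntSeries.transpose`
(DeShalit1987/KatzMeasureTwistedLines §1): the `k`-th coefficient of the line `T₁ = c` is the VALUE at
`c` of the one-variable series `[T₂^k]Gᵗ = ∑_i [T₁^i T₂^k]G · T^i` (`hasValueAt_coeff_transpose`).

## Contents (all proved)

* §1 algebra of values: `HasValueAt.sub`, `HasValueAt₂.sub`, `tendsto_coe_coeff_mul_pow`.
* §2 ONE variable: `eq_zero_of_infinite_zeros` (infinitely many zeros with `‖x‖ ≤ ‖ϖ‖ < 1` ⟹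
  `Q = 0`), `eq_of_infinite_hasValueAt_eq` (two series with the same value at infinitely many such
  points are equal), `eq_zero_of_forall_hasValueAt_zero` / `eq_of_forall_hasValueAt` (vanishing /
  agreement on the whole open disc; private plumbing: the points `p·n`, `n ∈ ℕ`, are infinitely many).
* §3 TWO variables: `hasValueAt_coeff_transpose` (coefficients of the line `T₁ = c` as values),
  `lineSubst_eq_zero_of_infinite_zeros`, `eq_zero_of_infinite_zeros₂` (zeros on `D₁ × D₂`, both
  infinite inside `‖·‖ ≤ ‖ϖ‖`), `eq_zero_of_forall_hasValueAt₂_zero`, `eq_of_forall_hasValueAt₂`.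
* §4 TWO variables, FIBRED zero sets: `eq_zero_of_infinite_zeros₂_fibred`,
  `eq_of_infinite_hasValueAt₂_eq_fibred` (for each `c` of an infinite `D₁`, infinitely many zeros /
  agreements on the line `T₁ = c`, the admissible second coordinates depending on `c` — the shape of a
  Zariski-dense interpolation set that is not a product).

## References

* F. Q. Gouvêa, *p-adic Numbers: An Introduction*, Universitext (1993/1997), §5.6 Cor. 5.6.3–5.6.4
  (the identity theorem on closed discs). [Gouvea1993PadicNumbers]
* E. de Shalit, *Iwasawa theory of elliptic curves with complex multiplication* (1987), II.4.17
  (51)–(54) (p. 77–78) (lines of the two-variable `G(χ; T₁, T₂)`), II.6.4 proof p. 85 ("enough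
  admissible `ε_G` to separate points in `𝐃[[G]]`"). [deShalit1987]
-/

noncomputable section

open Filter Topology

namespace Literature.NumberTheory.EllipticCurves

variable {p : ℕ} [Fact p.Prime]

namespace IntSeries

/-! ### §1. Algebra of values and the rescaled coefficients -/

/-- Values are additive: if `Q` has value `v` and `Q'` has value `v'` at `x`, then `Q − Q'` has value
`v − v'` at `x` (termwise difference of two convergent sums). [cite: Gouvea1993PadicNumbers, §5.6 Cor. 5.6.4 (proof)] -/
theorem HasValueAt.sub {Q Q' : PowerSeries (PadicComplexInt p)} {x v v' : ℂ_[p]}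
    (h : IntSeries.HasValueAt Q x v) (h' : IntSeries.HasValueAt Q' x v') :
    IntSeries.HasValueAt (Q - Q') x (v - v') := by
  unfold IntSeries.HasValueAt at *
  have hs := HasSum.sub h h'
  refine hs.congr_fun fun k => ?_
  rw [map_sub]
  push_cast
  ring

/-- Values are additive (two variables): if `G` has value `v` and `G'` has value `v'` at `(x, y)`,
then `G − G'` has value `v − v'` there (termwise difference of two absolutely convergent double sums).
[cite: deShalit1987, II.4.17 (54) (p. 78)] -/
theorem HasValueAt₂.sub {G G' : PowerSeries (PowerSeries (PadicComplexInt p))} {x y v v' : ℂ_[p]}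
    (h : IntSeries.HasValueAt₂ G x y v) (h' : IntSeries.HasValueAt₂ G' x y v') :
    IntSeries.HasValueAt₂ (G - G') x y (v - v') := by
  unfold IntSeries.HasValueAt₂ at *
  have hs := HasSum.sub h h'
  refine hs.congr_fun fun k => ?_
  rw [map_sub, map_sub]
  push_cast
  ring

/-- On a closed disc `‖x‖ ≤ ‖ϖ‖` with `‖ϖ‖ < 1` a bounded series becomes a Strassman series: the
rescaled coefficients `[T^n]Q · ϖ^n` tend to `0` (`‖[T^n]Q‖ ≤ 1`). [cite: Gouvea1993PadicNumbers, §5.6 Cor. 5.6.3 (proof)] -/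
theorem tendsto_coe_coeff_mul_pow (Q : PowerSeries (PadicComplexInt p)) {ϖ : ℂ_[p]} (hϖ : ‖ϖ‖ < 1) :
    Tendsto (fun n : ℕ => ((PowerSeries.coeff n Q : PadicComplexInt p) : ℂ_[p]) * ϖ ^ n)
      atTop (𝓝 0) := by
  refine squeeze_zero_norm (fun n => ?_) (tendsto_pow_atTop_nhds_zero_of_lt_one (norm_nonneg ϖ) hϖ)
  rw [norm_mul, norm_pow]
  exact mul_le_of_le_one_left (pow_nonneg (norm_nonneg _) _) (norm_coe_padicComplexInt_le_one _)

/-! ### §2. One variable -/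

/-- **The identity principle for `𝒪_{ℂ_p}⟦T⟧`, zeros form.** If `Q` vanishes at infinitely many points
of a closed disc `‖x‖ ≤ ‖ϖ‖` with `0 < ‖ϖ‖ < 1`, then `Q = 0` (Strassman for the rescaled series,
Gouvêa Cor. 5.6.3–5.6.4). [cite: Gouvea1993PadicNumbers, §5.6 Cor. 5.6.3 and Cor. 5.6.4] -/
theorem eq_zero_of_infinite_zeros {Q : PowerSeries (PadicComplexInt p)} {ϖ : ℂ_[p]} (hϖ0 : ϖ ≠ 0)
    (hϖ : ‖ϖ‖ < 1) (h : {x : ℂ_[p] | ‖x‖ ≤ ‖ϖ‖ ∧ IntSeries.HasValueAt Q x 0}.Infinite) : Q = 0 := by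
  by_contra hQ
  set a : ℕ → ℂ_[p] := fun n => ((PowerSeries.coeff n Q : PadicComplexInt p) : ℂ_[p]) with ha_def
  have ha : a ≠ 0 := by
    intro ha0
    apply hQ
    ext n
    have hn : a n = 0 := by rw [ha0]; rfl
    simp only [ha_def] at hn
    rw [map_zero]
    exact_mod_cast hn
  have hfin := Literature.NumberTheory.LocalFields.finite_zeros_closedBall hϖ0
    (tendsto_coe_coeff_mul_pow Q hϖ) ha
  exact h (hfin.subset fun x hx => ⟨hx.1, hx.2.tsum_eq⟩)

/-- **The identity principle for `𝒪_{ℂ_p}⟦T⟧`, agreement form**: two series taking the same value at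
infinitely many points of a closed disc `‖x‖ ≤ ‖ϖ‖`, `0 < ‖ϖ‖ < 1`, are equal.
[cite: Gouvea1993PadicNumbers, §5.6 Cor. 5.6.4] -/
theorem eq_of_infinite_hasValueAt_eq {Q Q' : PowerSeries (PadicComplexInt p)} {ϖ : ℂ_[p]}
    (hϖ0 : ϖ ≠ 0) (hϖ : ‖ϖ‖ < 1)
    (h : {x : ℂ_[p] | ‖x‖ ≤ ‖ϖ‖ ∧
      ∃ v : ℂ_[p], IntSeries.HasValueAt Q x v ∧ IntSeries.HasValueAt Q' x v}.Infinite) : Q = Q' := by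
  refine sub_eq_zero.mp (eq_zero_of_infinite_zeros hϖ0 hϖ (h.mono fun x hx => ⟨hx.1, ?_⟩))
  obtain ⟨v, hv, hv'⟩ := hx.2
  simpa using hv.sub hv'

/-- `‖p‖ = p⁻¹ < 1` and `p ≠ 0` in `ℂ_p`. [folklore] -/
private theorem norm_natCast_prime_lt_one_and_ne_zero :
    ‖((p : ℕ) : ℂ_[p])‖ < 1 ∧ ((p : ℕ) : ℂ_[p]) ≠ 0 := by
  have hnorm : ‖((p : ℕ) : ℂ_[p])‖ = (p : ℝ)⁻¹ := by
    rw [← map_natCast (algebraMap ℚ_[p] ℂ_[p]) p]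
    exact (PadicComplex.norm_extends' (p := p) (p : ℚ_[p])).trans Padic.norm_p
  refine ⟨?_, ?_⟩
  · rw [hnorm]
    exact inv_lt_one_of_one_lt₀ (by exact_mod_cast (Fact.out : p.Prime).one_lt)
  · rw [← norm_pos_iff, hnorm]
    exact inv_pos.mpr (by exact_mod_cast (Fact.out : p.Prime).pos)

/-- The points `ϖ · n`, `n ∈ ℕ`, are infinitely many distinct points of the closed disc `‖x‖ ≤ ‖ϖ‖`
(`ϖ ≠ 0`; `ℂ_p` has characteristic `0` and `‖n‖ ≤ 1`). [folklore] -/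
private theorem infinite_closedBall_natCast_mul {ϖ : ℂ_[p]} (hϖ0 : ϖ ≠ 0) {P : ℂ_[p] → Prop}
    (hP : ∀ x : ℂ_[p], ‖x‖ ≤ ‖ϖ‖ → P x) : {x : ℂ_[p] | ‖x‖ ≤ ‖ϖ‖ ∧ P x}.Infinite := by
  have hinj : Function.Injective fun k : ℕ => ϖ * (k : ℂ_[p]) :=
    fun k l hkl => Nat.cast_injective (mul_left_cancel₀ hϖ0 hkl)
  refine Set.infinite_of_injective_forall_mem hinj fun k => ?_
  have hk : ‖ϖ * (k : ℂ_[p])‖ ≤ ‖ϖ‖ := by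
    rw [norm_mul]
    exact mul_le_of_le_one_right (norm_nonneg _) (IsUltrametricDist.norm_natCast_le_one ℂ_[p] k)
  exact ⟨hk, hP _ hk⟩

/-- **A bounded series vanishing on the open unit disc is zero**: if `Q(x) = 0` for every `x ∈ ℂ_p`
with `‖x‖ < 1`, then `Q = 0`. [cite: Gouvea1993PadicNumbers, §5.6 Cor. 5.6.4] -/
theorem eq_zero_of_forall_hasValueAt_zero {Q : PowerSeries (PadicComplexInt p)}
    (h : ∀ x : ℂ_[p], ‖x‖ < 1 → IntSeries.HasValueAt Q x 0) : Q = 0 := by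
  obtain ⟨hp1, hp0⟩ := norm_natCast_prime_lt_one_and_ne_zero (p := p)
  exact eq_zero_of_infinite_zeros hp0 hp1
    (infinite_closedBall_natCast_mul hp0 fun x hx => h x (hx.trans_lt hp1))

/-- **A bounded series is determined by its values on the open unit disc**: if at every `x ∈ ℂ_p`,
`‖x‖ < 1`, the series `Q` and `Q'` have a common value, then `Q = Q'`.
[cite: Gouvea1993PadicNumbers, §5.6 Cor. 5.6.4] -/
theorem eq_of_forall_hasValueAt {Q Q' : PowerSeries (PadicComplexInt p)}
    (h : ∀ x : ℂ_[p], ‖x‖ < 1 →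
      ∃ v : ℂ_[p], IntSeries.HasValueAt Q x v ∧ IntSeries.HasValueAt Q' x v) : Q = Q' := by
  obtain ⟨hp1, hp0⟩ := norm_natCast_prime_lt_one_and_ne_zero (p := p)
  exact eq_of_infinite_hasValueAt_eq hp0 hp1
    (infinite_closedBall_natCast_mul hp0 fun x hx => h x (hx.trans_lt hp1))

/-! ### §3. Two variables -/

/-- **Coefficients of a line are values.** For `‖c‖ < 1`, the `k`-th coefficient of the line
`T₁ = c` of `G` (`lineSubst c G`) is the value at `T = c` of the one-variable series
`[T₂^k] Gᵗ = ∑_i [T₁^i T₂^k]G · T^i`. [cite: deShalit1987, II.4.17 (51)–(54) (p. 77–78)] -/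
theorem hasValueAt_coeff_transpose (G : PowerSeries (PowerSeries (PadicComplexInt p)))
    {c : PadicComplexInt p} (hc : ‖(c : ℂ_[p])‖ < 1) (k : ℕ) :
    IntSeries.HasValueAt (PowerSeries.coeff k (transpose G)) c
      ((PowerSeries.coeff k (lineSubst c G) : PadicComplexInt p) : ℂ_[p]) := by
  unfold IntSeries.HasValueAt
  rw [coe_coeff_lineSubst]
  have hs := (summable_coeff_mul_pow G hc k).hasSum
  refine hs.congr_fun fun i => ?_
  rw [coeff_coeff_transpose]

/-- **A line with infinitely many zeros vanishes**: if `‖c‖ < 1` and `G(c, y) = 0` for infinitely many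
`y` in a closed disc `‖y‖ ≤ ‖ϖ‖`, `0 < ‖ϖ‖ < 1`, then `lineSubst c G = 0`.
[cite: Gouvea1993PadicNumbers, §5.6 Cor. 5.6.4] [cite: deShalit1987, II.4.17 (54) (p. 78)] -/
theorem lineSubst_eq_zero_of_infinite_zeros (G : PowerSeries (PowerSeries (PadicComplexInt p)))
    {c : PadicComplexInt p} (hc : ‖(c : ℂ_[p])‖ < 1) {ϖ : ℂ_[p]} (hϖ0 : ϖ ≠ 0) (hϖ : ‖ϖ‖ < 1)
    (h : {y : ℂ_[p] | ‖y‖ ≤ ‖ϖ‖ ∧ IntSeries.HasValueAt₂ G c y 0}.Infinite) : lineSubst c G = 0 :=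
  eq_zero_of_infinite_zeros hϖ0 hϖ (h.mono fun _ hy =>
    ⟨hy.1, (hasValueAt_lineSubst_iff G hc (hy.1.trans_lt hϖ) 0).mpr hy.2⟩)

/-- **The identity principle for `𝒪_{ℂ_p}⟦T₁⟧⟦T₂⟧`, zeros form.** If `G(c, y) = 0` for all
`c ∈ D₁`, `y ∈ D₂`, where `D₁ ⊆ 𝒪_{ℂ_p}` and `D₂ ⊆ ℂ_p` are INFINITE subsets of a closed disc of radius
`‖ϖ‖`, `0 < ‖ϖ‖ < 1`, then `G = 0`: each line `T₁ = c`, `c ∈ D₁`, vanishes, so each coefficient series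
`[T₂^k]Gᵗ` has the infinitely many zeros `D₁`. [cite: Gouvea1993PadicNumbers, §5.6 Cor. 5.6.4] [cite: deShalit1987, II.6.4 proof (p. 85)] -/
theorem eq_zero_of_infinite_zeros₂ {G : PowerSeries (PowerSeries (PadicComplexInt p))} {ϖ : ℂ_[p]}
    (hϖ0 : ϖ ≠ 0) (hϖ : ‖ϖ‖ < 1) {D₁ : Set (PadicComplexInt p)} {D₂ : Set ℂ_[p]}
    (hD₁ : D₁.Infinite) (hD₁ϖ : ∀ c ∈ D₁, ‖(c : ℂ_[p])‖ ≤ ‖ϖ‖)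
    (hD₂ : D₂.Infinite) (hD₂ϖ : ∀ y ∈ D₂, ‖y‖ ≤ ‖ϖ‖)
    (h : ∀ c ∈ D₁, ∀ y ∈ D₂, IntSeries.HasValueAt₂ G c y 0) : G = 0 := by
  -- every line `T₁ = c`, `c ∈ D₁`, vanishes
  have hline : ∀ c ∈ D₁, lineSubst c G = 0 := fun c hc =>
    lineSubst_eq_zero_of_infinite_zeros G ((hD₁ϖ c hc).trans_lt hϖ) hϖ0 hϖ
      (hD₂.mono fun y hy => ⟨hD₂ϖ y hy, h c hc y hy⟩)
  -- hence every coefficient series of the transpose vanishes on `D₁`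
  have hcoeff : ∀ k : ℕ, PowerSeries.coeff k (transpose G) = 0 := by
    intro k
    refine eq_zero_of_infinite_zeros hϖ0 hϖ ((hD₁.image Subtype.coe_injective.injOn).mono ?_)
    rintro x ⟨c, hc, rfl⟩
    refine ⟨hD₁ϖ c hc, ?_⟩
    have hv := hasValueAt_coeff_transpose G ((hD₁ϖ c hc).trans_lt hϖ) k
    rw [hline c hc, map_zero] at hv
    simpa using hv
  have ht : transpose G = 0 := PowerSeries.ext fun k => by rw [hcoeff k, map_zero]
  calc G = transpose (transpose G) := (transpose_transpose G).symm
    _ = transpose 0 := by rw [ht]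
    _ = 0 := by ext i j; simp

/-- The elements `p · n ∈ 𝒪_{ℂ_p}`, `n ∈ ℕ`, form an infinite subset of the closed disc of radius
`‖p‖`. [folklore] -/
private theorem exists_infinite_padicComplexInt_norm_le :
    ∃ D : Set (PadicComplexInt p), D.Infinite ∧ ∀ c ∈ D, ‖(c : ℂ_[p])‖ ≤ ‖((p : ℕ) : ℂ_[p])‖ := by
  obtain ⟨hp1, hp0⟩ := norm_natCast_prime_lt_one_and_ne_zero (p := p)
  have hk : ∀ k : ℕ, ‖((p : ℕ) : ℂ_[p]) * (k : ℂ_[p])‖ ≤ ‖((p : ℕ) : ℂ_[p])‖ := fun k => by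
    rw [norm_mul]
    exact mul_le_of_le_one_right (norm_nonneg _) (IsUltrametricDist.norm_natCast_le_one ℂ_[p] k)
  let f : ℕ → PadicComplexInt p := fun k =>
    ⟨((p : ℕ) : ℂ_[p]) * (k : ℂ_[p]), mem_padicComplexInt_iff.mpr ((hk k).trans hp1.le)⟩
  have hinj : Function.Injective f := fun k l hkl => by
    have h' : ((p : ℕ) : ℂ_[p]) * (k : ℂ_[p]) = ((p : ℕ) : ℂ_[p]) * (l : ℂ_[p]) :=
      congrArg (fun c : PadicComplexInt p => (c : ℂ_[p])) hkl
    exact Nat.cast_injective (mul_left_cancel₀ hp0 h')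
  exact ⟨Set.range f, Set.infinite_range_of_injective hinj, by rintro c ⟨k, rfl⟩; exact hk k⟩

/-- **A bounded two-variable series vanishing on the open unit polydisc is zero**: if `G(x, y) = 0`
for all `x, y ∈ ℂ_p` with `‖x‖, ‖y‖ < 1`, then `G = 0`. [cite: Gouvea1993PadicNumbers, §5.6 Cor. 5.6.4] [cite: deShalit1987, II.6.4 proof (p. 85)] -/
theorem eq_zero_of_forall_hasValueAt₂_zero {G : PowerSeries (PowerSeries (PadicComplexInt p))}
    (h : ∀ x y : ℂ_[p], ‖x‖ < 1 → ‖y‖ < 1 → IntSeries.HasValueAt₂ G x y 0) : G = 0 := by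
  obtain ⟨hp1, hp0⟩ := norm_natCast_prime_lt_one_and_ne_zero (p := p)
  obtain ⟨D, hD, hDp⟩ := exists_infinite_padicComplexInt_norm_le (p := p)
  refine eq_zero_of_infinite_zeros₂ hp0 hp1 hD hDp
    (infinite_closedBall_natCast_mul hp0 (P := fun _ => True) fun _ _ => trivial)
    (fun y hy => hy.1) fun c hc y hy => ?_
  exact h c y ((hDp c hc).trans_lt hp1) (hy.1.trans_lt hp1)

/-- **A bounded two-variable series is determined by its values on the open unit polydisc**: if at
every `(x, y)` with `‖x‖, ‖y‖ < 1` the series `G` and `G'` have a common value, then `G = G'` — the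
form in which a POINTWISE relation between two-variable frames (e.g. the `p`-adic functional equation
`DeShalit1987.thmII64_katzMeasure₂_functionalEquation`, stated value by value) becomes an identity of
power series. [cite: deShalit1987, II.6.4 proof (p. 85)] [cite: Gouvea1993PadicNumbers, §5.6 Cor. 5.6.4] -/
theorem eq_of_forall_hasValueAt₂ {G G' : PowerSeries (PowerSeries (PadicComplexInt p))}
    (h : ∀ x y : ℂ_[p], ‖x‖ < 1 → ‖y‖ < 1 →
      ∃ v : ℂ_[p], IntSeries.HasValueAt₂ G x y v ∧ IntSeries.HasValueAt₂ G' x y v) : G = G' := by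
  refine sub_eq_zero.mp (eq_zero_of_forall_hasValueAt₂_zero fun x y hx hy => ?_)
  obtain ⟨v, hv, hv'⟩ := h x y hx hy
  simpa using hv.sub hv'

/-! ### §4. Two variables, FIBRED zero sets (the shape of an interpolation set that is dense but not a
product: for infinitely many first coordinates `c`, infinitely many second coordinates `y`, the admissible
`y` depending on `c` — e.g. the crystalline points `(f, θ^t g)`, "for every `g` infinitely many `f`", of a
two-variable `p`-adic `L`-function, or the characters `ψ₀ N^m λ^n` of a toric family read in an adapted
frame) -/

/-- **The identity principle for `𝒪_{ℂ_p}⟦T₁⟧⟦T₂⟧`, FIBRED zeros form.** Let `D₁ ⊆ 𝒪_{ℂ_p}` be an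
infinite subset of a closed disc `‖c‖ ≤ ‖ϖ‖`, `0 < ‖ϖ‖ < 1`, and suppose that for EVERY `c ∈ D₁` the line
`T₁ = c` carries infinitely many zeros of `G` inside some closed disc `‖y‖ ≤ ‖ϖ_c‖`, `0 < ‖ϖ_c‖ < 1`
(the disc and the zeros may depend on `c`). Then `G = 0`. The product case `D₁ × D₂` is
`eq_zero_of_infinite_zeros₂`; the proof is the same (each line vanishes, then each coefficient series of
the transpose has the infinitely many zeros `D₁`). [cite: Gouvea1993PadicNumbers, §5.6 Cor. 5.6.4] [cite: deShalit1987, II.6.4 proof (p. 85)] -/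
theorem eq_zero_of_infinite_zeros₂_fibred {G : PowerSeries (PowerSeries (PadicComplexInt p))}
    {ϖ : ℂ_[p]} (hϖ0 : ϖ ≠ 0) (hϖ : ‖ϖ‖ < 1) {D₁ : Set (PadicComplexInt p)} (hD₁ : D₁.Infinite)
    (hD₁ϖ : ∀ c ∈ D₁, ‖(c : ℂ_[p])‖ ≤ ‖ϖ‖)
    (h : ∀ c ∈ D₁, ∃ ϖ' : ℂ_[p], ϖ' ≠ 0 ∧ ‖ϖ'‖ < 1 ∧
      {y : ℂ_[p] | ‖y‖ ≤ ‖ϖ'‖ ∧ IntSeries.HasValueAt₂ G c y 0}.Infinite) : G = 0 := by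
  -- every line `T₁ = c`, `c ∈ D₁`, vanishes
  have hline : ∀ c ∈ D₁, lineSubst c G = 0 := fun c hc => by
    obtain ⟨ϖ', hϖ'0, hϖ', hinf⟩ := h c hc
    exact lineSubst_eq_zero_of_infinite_zeros G ((hD₁ϖ c hc).trans_lt hϖ) hϖ'0 hϖ' hinf
  -- hence every coefficient series of the transpose vanishes on `D₁`
  have hcoeff : ∀ k : ℕ, PowerSeries.coeff k (transpose G) = 0 := by
    intro k
    refine eq_zero_of_infinite_zeros hϖ0 hϖ ((hD₁.image Subtype.coe_injective.injOn).mono ?_)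
    rintro x ⟨c, hc, rfl⟩
    refine ⟨hD₁ϖ c hc, ?_⟩
    have hv := hasValueAt_coeff_transpose G ((hD₁ϖ c hc).trans_lt hϖ) k
    rw [hline c hc, map_zero] at hv
    simpa using hv
  have ht : transpose G = 0 := PowerSeries.ext fun k => by rw [hcoeff k, map_zero]
  calc G = transpose (transpose G) := (transpose_transpose G).symm
    _ = transpose 0 := by rw [ht]
    _ = 0 := by ext i j; simp

/-- **The identity principle for `𝒪_{ℂ_p}⟦T₁⟧⟦T₂⟧`, FIBRED agreement form**: if for every `c` in an
infinite subset `D₁` of a closed disc `‖c‖ ≤ ‖ϖ‖ < 1` the series `G` and `G'` take a common value at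
infinitely many points `(c, y)` of some closed disc `‖y‖ ≤ ‖ϖ_c‖ < 1` in the second variable, then
`G = G'` — the form in which a relation between two two-variable frames established point by point on a
Zariski-dense FIBRED set becomes an identity of power series.
[cite: deShalit1987, II.6.4 proof (p. 85)] [cite: Gouvea1993PadicNumbers, §5.6 Cor. 5.6.4] -/
theorem eq_of_infinite_hasValueAt₂_eq_fibred {G G' : PowerSeries (PowerSeries (PadicComplexInt p))}
    {ϖ : ℂ_[p]} (hϖ0 : ϖ ≠ 0) (hϖ : ‖ϖ‖ < 1) {D₁ : Set (PadicComplexInt p)} (hD₁ : D₁.Infinite)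
    (hD₁ϖ : ∀ c ∈ D₁, ‖(c : ℂ_[p])‖ ≤ ‖ϖ‖)
    (h : ∀ c ∈ D₁, ∃ ϖ' : ℂ_[p], ϖ' ≠ 0 ∧ ‖ϖ'‖ < 1 ∧
      {y : ℂ_[p] | ‖y‖ ≤ ‖ϖ'‖ ∧
        ∃ v : ℂ_[p], IntSeries.HasValueAt₂ G c y v ∧ IntSeries.HasValueAt₂ G' c y v}.Infinite) :
    G = G' := by
  refine sub_eq_zero.mp (eq_zero_of_infinite_zeros₂_fibred hϖ0 hϖ hD₁ hD₁ϖ fun c hc => ?_)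
  obtain ⟨ϖ', hϖ'0, hϖ', hinf⟩ := h c hc
  refine ⟨ϖ', hϖ'0, hϖ', hinf.mono fun y hy => ⟨hy.1, ?_⟩⟩
  obtain ⟨v, hv, hv'⟩ := hy.2
  simpa using hv.sub hv'

end IntSeries

end Literature.NumberTheory.EllipticCurves

end
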